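import Mathlib
import HarnessLib
import Summits.Ventures.LatticeQCDFlow.Scoring.MarkovChainCLTStudentized
import Summits.Ventures.LatticeQCDFlow.Scoring.RestartChainRegenerative

/-!
# Non-equilibrium evolutions restarted from a prior chain: the run's OWN studentised error bar for
# the time average of a record observable is asymptotically exact, from any start

HONEST FRAMING: exact (Metropolis-corrected) sampling algorithms for lattice gauge theory;
figures of merit are autocorrelation/cost numbers at stated couplings and volumes; no
continuum-physics claim.

Venture `LatticeQCDFlow` (cell pub-lqcd), topic `Scoring`; FANOUT row 8 (`s0-cpn-nemc`, GEN-18 —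
the row's own protocol: non-equilibrium evolutions started every `n_between` sweeps of an
equilibrium prior chain; Bonanno–Nada–Vadacchino 2024 NAMED ONLY).  NEW WORK of the cell, not a
published result; no definition is introduced.  Setting of `Scoring/RestartChainRegenerative.lean`
and `Scoring/RestartChainRegenerativeCLT.lean`: prior sweep `κ₀` with invariant `π₀` and Doeblin
constant `ε` w.r.t. `π₀`, record kernel `κF`, restart chain `K = prodMkRight κ₀ ⊗ₖ prodMkLeft κF`
(invariant law `Π = π₀ ⊗ₘ κF`, Doeblin constant `ε`), `κs` its split kernel, `P̂` the split chain's
path law from ANY initial law `μs`; `G` a bounded measurable record observable with Green–Kubo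
variance `σ²_G > 0` along `K`.  With `R_n = K_{n−1} − 1` completed tours by time `n − 1` and
`σ̂²_n = V̂_{R_n} / N̄_{R_n}` the tour estimator (`Scoring/MarkovChainCLTStudentized.lean`):

* `restart_sigmaHat_strongLaw` — `σ̂²_n → σ²_G` almost surely;
* `restart_timeAverage_studentized_coverage` — `z > 0`:
  `P̂(|(√n)⁻¹ Σ_{t<n} (G(x_t) − Π G)| ≤ z σ̂_n) → (gaussianReal 0 1)[−z, z]` — the interval
  `Ḡ_n ± z σ̂_n / √n` for the NE-MCMC average computed from the run alone is asymptotically exact.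

NOT CLAIMED: any `ε` of a concrete sweep; rates; unbounded weights; the case `σ²_G = 0`.
-/

noncomputable section

namespace Summit.Ventures.LatticeQCDFlow.Scoring

open MeasureTheory ProbabilityTheory Filter Finset Preorder
open Literature.Probability.MarkovChains
open scoped ENNReal Topology

variable {Ω E : Type*} [MeasurableSpace Ω] [MeasurableSpace E]

section Restart

variable {κ₀ : Kernel Ω Ω} [IsMarkovKernel κ₀] {κF : Kernel Ω E} [IsMarkovKernel κF]
  {π₀ : Measure Ω} [IsProbabilityMeasure π₀] {ε : ℝ≥0∞}
  (κs : Kernel ((Ω × E) × Bool) ((Ω × E) × Bool)) [IsMarkovKernel κs]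
  (μs : Measure ((Ω × E) × Bool)) [IsProbabilityMeasure μs]

/-- **The NE-MCMC run's own variance estimate is strongly consistent**: `σ̂²_n → σ²_G` a.s. -/
theorem restart_sigmaHat_strongLaw (hπ₀ : Kernel.Invariant κ₀ π₀)
    (hmin : ∀ x {B : Set Ω}, MeasurableSet B → ε * π₀ B ≤ κ₀ x B) (hε0 : 0 < ε) (hε : ε < 1)
    (hκs : ∀ p, κs p = (ε • (π₀ ⊗ₘ κF)).map (fun y : Ω × E => (y, true))
      + ((1 - ε) • Doeblin.residualKernel ((Kernel.prodMkRight E κ₀) ⊗ₖ (Kernel.prodMkLeft (Ω × E) κF))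
          (π₀ ⊗ₘ κF) ε (fun p _ hS => restart_doeblin (κF := κF) hmin p hS) p.1).map
        (fun y : Ω × E => (y, false)))
    {G : Ω × E → ℝ} (hG : Measurable G) {C : ℝ} (hC : ∀ p, |G p| ≤ C) :
    ∀ᵐ x ∂(Kernel.trajMeasure (X := fun _ : ℕ => (Ω × E) × Bool) μs
        (fun n : ℕ => κs.comap (fun h : (i : ↥(Finset.Iic n)) → (Ω × E) × Bool =>
          h ⟨n, Finset.mem_Iic.2 le_rfl⟩) (measurable_pi_apply _))),
      Tendsto (fun n : ℕ => (((∑ i ∈ Finset.range (((∑ s ∈ Finset.range (n - 1), (if (x (s + 1)).2 then (1 : ℕ) else 0)) - 1 : ℕ)), ((∑' u, (if (∑ s ∈ Finset.range u, (if (x (s + 1)).2 then (1 : ℕ) else 0)) = i + 1 then (1 : ℝ) else 0) * G (x u).1) - ((∑ i ∈ Finset.range (((∑ s ∈ Finset.range (n - 1), (if (x (s + 1)).2 then (1 : ℕ) else 0)) - 1 : ℕ)), (∑' u, (if (∑ s ∈ Finset.range u, (if (x (s + 1)).2 then (1 : ℕ) else 0)) = i + 1 then (1 : ℝ) else 0)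 * G (x u).1)) / (∑ i ∈ Finset.range (((∑ s ∈ Finset.range (n - 1), (if (x (s + 1)).2 then (1 : ℕ) else 0)) - 1 : ℕ)), (∑' u, (if (∑ s ∈ Finset.range u, (if (x (s + 1)).2 then (1 : ℕ) else 0)) = i + 1 then (1 : ℝ) else 0)))) * (∑' u, (if (∑ s ∈ Finset.range u, (if (x (s + 1)).2 then (1 : ℕ) else 0)) = i + 1 then (1 : ℝ) else 0))) ^ 2) / (((∑ s ∈ Finset.range (n - 1), (if (x (s + 1)).2 then (1 : ℕ) else 0)) - 1 : ℕ))) / ((∑ i ∈ Finset.range (((∑ s ∈ Finset.range (n - 1), (if (x (s + 1)).2 then (1 : ℕ) else 0)) - 1 : ℕ)), (∑' u, (if (∑ s ∈ Finset.range u, (if (x (s + 1)).2 then (1 : ℕ) else 0)) = i + 1 then (1 : ℝ) else 0))) / (((∑ s ∈ Finset.range (n - 1), (if (x (s + 1)).2 then (1 : ℕ) else 0)) - 1 : ℕ))))) atTop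
        (𝓝 ((∫ p, (G p - ∫ p', G p' ∂(π₀ ⊗ₘ κF)) ^ 2 ∂(π₀ ⊗ₘ κF))
          + 2 * ∑' k, ∫ p, (G p - ∫ p', G p' ∂(π₀ ⊗ₘ κF))
            * (kop ((Kernel.prodMkRight E κ₀) ⊗ₖ (Kernel.prodMkLeft (Ω × E) κF)))^[k + 1]
              (fun p => G p - ∫ p', G p' ∂(π₀ ⊗ₘ κF)) p ∂(π₀ ⊗ₘ κF))) :=
  splitChain_sigmaHat_strongLaw κs μs (κ := ((Kernel.prodMkRight E κ₀) ⊗ₖ (Kernel.prodMkLeft (Ω × E) κF))) (ν := π₀ ⊗ₘ κF)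
    (hmin := fun p _ hS => restart_doeblin (κF := κF) hmin p hS) (invariant_restart hπ₀) hε0 hε hκs
    hG hC

/-- **THE NE-MCMC RUN'S OWN ERROR BAR IS ASYMPTOTICALLY EXACT**: `σ²_G > 0`, `z > 0`, any start:
`P̂(|(√n)⁻¹ Σ_{t<n} (G(x_t) − Π G)| ≤ z σ̂_n) → (gaussianReal 0 1)[−z, z]`. -/
theorem restart_timeAverage_studentized_coverage (hπ₀ : Kernel.Invariant κ₀ π₀)
    (hmin : ∀ x {B : Set Ω}, MeasurableSet B → ε * π₀ B ≤ κ₀ x B) (hε0 : 0 < ε) (hε : ε < 1)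
    (hκs : ∀ p, κs p = (ε • (π₀ ⊗ₘ κF)).map (fun y : Ω × E => (y, true))
      + ((1 - ε) • Doeblin.residualKernel ((Kernel.prodMkRight E κ₀) ⊗ₖ (Kernel.prodMkLeft (Ω × E) κF))
          (π₀ ⊗ₘ κF) ε (fun p _ hS => restart_doeblin (κF := κF) hmin p hS) p.1).map
        (fun y : Ω × E => (y, false)))
    {G : Ω × E → ℝ} (hG : Measurable G) {C : ℝ} (hC : ∀ p, |G p| ≤ C)
    (hσ : 0 < ((∫ p, (G p - ∫ p', G p' ∂(π₀ ⊗ₘ κF)) ^ 2 ∂(π₀ ⊗ₘ κF))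
          + 2 * ∑' k, ∫ p, (G p - ∫ p', G p' ∂(π₀ ⊗ₘ κF))
            * (kop ((Kernel.prodMkRight E κ₀) ⊗ₖ (Kernel.prodMkLeft (Ω × E) κF)))^[k + 1]
              (fun p => G p - ∫ p', G p' ∂(π₀ ⊗ₘ κF)) p ∂(π₀ ⊗ₘ κF))) {z : ℝ} (hz : 0 < z) :
    Tendsto (fun n : ℕ => (Kernel.trajMeasure (X := fun _ : ℕ => (Ω × E) × Bool) μs
        (fun n : ℕ => κs.comap (fun h : (i : ↥(Finset.Iic n)) → (Ω × E) × Bool =>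
          h ⟨n, Finset.mem_Iic.2 le_rfl⟩) (measurable_pi_apply _))).real
      {x | |((Real.sqrt n)⁻¹ * ∑ t ∈ Finset.range n, (G (x t).1 - ∫ p, G p ∂(π₀ ⊗ₘ κF))) / Real.sqrt (((∑ i ∈ Finset.range (((∑ s ∈ Finset.range (n - 1), (if (x (s + 1)).2 then (1 : ℕ) else 0)) - 1 : ℕ)), ((∑' u, (if (∑ s ∈ Finset.range u, (if (x (s + 1)).2 then (1 : ℕ) else 0)) = i + 1 then (1 : ℝ) else 0) * G (x u).1) - ((∑ i ∈ Finset.range (((∑ s ∈ Finset.range (n - 1), (if (x (s + 1)).2 then (1 : ℕ) else 0)) - 1 : ℕ)), (∑' u, (if (∑ s ∈ Finset.range u, (if (x (s + 1)).2 then (1 : ℕ) else 0)) = i + 1 then (1 : ℝ) else 0) * G (x u).1)) / (∑ i ∈ Finset.range (((∑ s ∈ Finset.range (n - 1), (if (x (s + 1)).2 then (1 : ℕ) else 0)) - 1 : ℕ)), (∑' u, (if (∑ s ∈ Finset.range u, (if (x (s + 1)).2 then (1 : ℕ) else 0)) = i + 1 then (1 : ℝ) else 0)))) * (∑' u, (if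 (∑ s ∈ Finset.range u, (if (x (s + 1)).2 then (1 : ℕ) else 0)) = i + 1 then (1 : ℝ) else 0))) ^ 2) / (((∑ s ∈ Finset.range (n - 1), (if (x (s + 1)).2 then (1 : ℕ) else 0)) - 1 : ℕ))) / ((∑ i ∈ Finset.range (((∑ s ∈ Finset.range (n - 1), (if (x (s + 1)).2 then (1 : ℕ) else 0)) - 1 : ℕ)), (∑' u, (if (∑ s ∈ Finset.range u, (if (x (s + 1)).2 then (1 : ℕ) else 0)) = i + 1 then (1 : ℝ) else 0))) / (((∑ s ∈ Finset.range (n - 1), (if (x (s + 1)).2 then (1 : ℕ) else 0)) - 1 : ℕ))))| ≤ z})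
      atTop (𝓝 ((gaussianReal 0 1).real (Set.Icc (-z) z))) :=
  splitChain_timeAverage_studentized_coverage κs μs (κ := ((Kernel.prodMkRight E κ₀) ⊗ₖ (Kernel.prodMkLeft (Ω × E) κF))) (ν := π₀ ⊗ₘ κF)
    (hmin := fun p _ hS => restart_doeblin (κF := κF) hmin p hS) (invariant_restart hπ₀) hε0 hε hκs
    hG hC hσ hz

end Restart

end Summit.Ventures.LatticeQCDFlow.Scoring

end
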